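import Summits.NavierStokesRegularity.NavierStokesRegularity.Theorems.ScalingDefectPeepholeDoorSerrinTypeI
import Summits.NavierStokesRegularity.NavierStokesRegularity.Theorems.ScalingDefectPeepholeDoorRigidity
import HarnessLib

/-!
# ScalingDefectPeepholeDoorRigidityU — door S30 «ScalingDefectPeepholeDoor», effective plate E0 (step E5):
# LEG Cω with the EFFECTIVE quantifier order — the lateness before the pressure level

Tenth file of the pressure-free Serrin chain and its purpose (nsreg-p1 g25 ROUND-29 §7, ADDENDUM-28A: "the vorticity-side
envelopes are pressure-free — `C_p` never enters LEG Cω").  The tree's LEG Cω `quietVortexCoreRigidity_holds`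
(`…Rigidity`, p615916) gives, for `C_u, θ, R`, constants `η, L` and for every pressure level `C_p` a lateness `s₁(C_p)`;
the dependence on `C_p` came only from the scale `c₁(B_u, B_p)` of the one-slice derivative bounds.  With the
pressure-free bounds `Serrin.exists_forall_iteratedFDeriv_le_of_typeI_pfree` (step E4, scale `c₁ = 1/2`) the same
compactness–Liouville proof runs with `s₁` fixed BEFORE `C_p`: `coreVortexDefect_vorticity_small_U`.  The by-name form
`QuietVortexCoreRigidityU` (Sketch31 v2.1 Part B) is concluded in a sequel once its text is in `…Defs`.

Door S30 is a regularity CRITERION inside a HYPOTHETICAL local Type-I blow-up; item 0056 `NoTypeII`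
stays OPEN; nothing here bears on NS regularity itself.
-/

noncomputable section

set_option linter.dupNamespace false

namespace Summit.NavierStokesRegularity.NavierStokesRegularity.Theorems.ScalingDefectPeepholeDoor

open MeasureTheory Set Function Filter Metric TopologicalSpace InnerProductSpace
open scoped ENNReal NNReal InnerProductSpace RealInnerProductSpace Laplacian Topology
open Literature.Analysis Literature.Analysis.FluidPDE
open Summit.NavierStokesRegularity.NavierStokesRegularity.Theorems.StableStrataDoorDefs (physWindowField)

-- nested operator types (`ℝ³ →L ℝ³ →L ℝ³`)
set_option maxSynthPendingDepth 3

set_option maxHeartbeats 3200000 in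
/-- **One-slice rigidity of the quiet vortex core, EFFECTIVE ORDER** (the analytic content of `QuietVortexCoreRigidityU`:
the lateness `s₁` comes BEFORE the annular pressure level `C_p`): for `C_u > 0`, `θ > 0`, `R ≥ 2` there are `η > 0`,
a core radius `L ≥ 1` AND a lateness `s₁ ≥ 1` such that for every `C_p`, every classical solution on `[−1,0) × B₁`
(`ν = 1`, `f = 0`) with the Type I bound (1.15) and `|p| ≤ C_p` on `{1/2 < |x| < 3/4}` (1.16), whose window field
`W = √(−t̄) u(t̄, √(−t̄)·)` at ONE `t̄ ∈ (−e^{−s₁}, 0)` has vorticity defect `≤ η` on `B(0, L)`, has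
`∫_{B(0,2R√(−t̄))} |ω(t̄)|² ≤ θ²/(4√(−t̄))`.  Proof = `coreVortexDefect_vorticity_small` (p615916) VERBATIM with ONE change:
the one-slice derivative bounds come from the PRESSURE-FREE `Serrin.exists_forall_iteratedFDeriv_le_of_typeI_pfree`
(scale `c₁(k)` independent of the solution) instead of `exists_forall_iteratedFDeriv_le_of_typeI_of_bounds`
(scale `c₁(B_u, B_p)`), so the lateness is fixed before `C_p` and the adversary chooses `C_p` afterwards; the shell bound
(1.16) is not used at all.  [cite: PineauVicol2026, Thm 1.9 / §9.3, arXiv:2607.09619; Serrin1962] -/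
theorem coreVortexDefect_vorticity_small_U :
    ∀ Cu : ℝ, 0 < Cu → ∀ θ : ℝ, 0 < θ → ∀ R : ℝ, 2 ≤ R → ∃ η : ℝ, 0 < η ∧ ∃ L : ℝ, 1 ≤ L ∧
      ∃ s₁ : ℝ, 1 ≤ s₁ ∧ ∀ Cp : ℝ, 0 < Cp →
      ∀ (u : ℝ → EuclideanSpace ℝ (Fin 3) → EuclideanSpace ℝ (Fin 3))
        (p : ℝ → EuclideanSpace ℝ (Fin 3) → ℝ),
        IsClassicalNSSolutionOnRegion
          (Ico (-1 : ℝ) 0 ×ˢ ball (0 : EuclideanSpace ℝ (Fin 3)) 1) 1 0 u p →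
        (∀ t ∈ Ico (-1 : ℝ) 0, ∀ x ∈ ball (0 : EuclideanSpace ℝ (Fin 3)) 1,
          ‖u t x‖ ≤ Cu / (Real.sqrt (-t) + ‖x‖)) →
        (∀ t ∈ Ico (-1 : ℝ) 0, ∀ x : EuclideanSpace ℝ (Fin 3), 1 / 2 < ‖x‖ → ‖x‖ < 3 / 4 →
          |p t x| ≤ Cp) →
        ∀ tb : ℝ, -Real.exp (-s₁) < tb → tb < 0 →
          (∀ W : EuclideanSpace ℝ (Fin 3) → EuclideanSpace ℝ (Fin 3),
            W = (fun w => Real.sqrt (-tb) • u tb (Real.sqrt (-tb) • w)) →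
            ∀ y ∈ ball (0 : EuclideanSpace ℝ (Fin 3)) L,
              ‖curl (fun z => (1 : ℝ) • (Δ W) z - fderiv ℝ W z (W z) - (1 / 2 : ℝ) • W z
                - (1 / 2 : ℝ) • fderiv ℝ W z z) y‖ ≤ η) →
          ∫⁻ x in ball (0 : EuclideanSpace ℝ (Fin 3)) (2 * R * Real.sqrt (-tb)),
              ENNReal.ofReal (‖curl (u tb) x‖ ^ 2) ≤
            ENNReal.ofReal (θ ^ 2 / (4 * Real.sqrt (-tb))) := by
  intro Cu hCu θ hθ R hR
  have hR0 : 0 < R := by linarith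
  by_contra H
  push Not at H
  /- Step 0: uniform constants — PRESSURE-FREE: the scales `c₁ k` do not depend on the solution (Serrin chain E1–E4). -/
  choose K hK0 c₁ hc₁ Hd using fun k : ℕ => Serrin.exists_forall_iteratedFDeriv_le_of_typeI_pfree k Cu
  -- the common radius of validity of the derivative bounds of orders `0, …, 3` (a constant sequence)
  obtain ⟨cmin, hcmin_def⟩ : ∃ cmin : ℕ → ℝ, ∀ n : ℕ,
      cmin n = min (min (c₁ 0) (c₁ 1)) (min (c₁ 2) (c₁ 3)) := ⟨_, fun _ => rfl⟩
  have hcmin : ∀ n, 0 < cmin n := fun n => by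
    rw [hcmin_def]; exact lt_min (lt_min (hc₁ 0) (hc₁ 1)) (lt_min (hc₁ 2) (hc₁ 3))
  have hcm0 : ∀ n, cmin n ≤ c₁ 0 := fun n => by
    rw [hcmin_def]; exact (min_le_left _ _).trans (min_le_left _ _)
  have hcm1 : ∀ n, cmin n ≤ c₁ 1 := fun n => by
    rw [hcmin_def]; exact (min_le_left _ _).trans (min_le_right _ _)
  have hcm2 : ∀ n, cmin n ≤ c₁ 2 := fun n => by
    rw [hcmin_def]; exact (min_le_right _ _).trans (min_le_left _ _)
  have hcm3 : ∀ n, cmin n ≤ c₁ 3 := fun n => by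
    rw [hcmin_def]; exact (min_le_right _ _).trans (min_le_right _ _)
  -- the size `Aₙ` the scale `cₙ = √(−t̄ₙ)` has to beat, and the corresponding `s₁`
  obtain ⟨A, hA_def⟩ : ∃ A : ℕ → ℝ, ∀ n,
      A n = ((n : ℝ) + 2) / cmin n + 2 * ((n : ℝ) + 2) + 4 * R + 1 := ⟨_, fun _ => rfl⟩
  have hA : ∀ n, 0 < A n := fun n => by
    rw [hA_def]
    have := hcmin n
    positivity
  obtain ⟨S, hS_def⟩ : ∃ S : ℕ → ℝ, ∀ n, S n = max 1 (2 * A n) := ⟨_, fun _ => rfl⟩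
  have hS1 : ∀ n, 1 ≤ S n := fun n => by rw [hS_def]; exact le_max_left _ _
  /- Step 1: the contradicting sequence (the pressure level `C_p n` is chosen by the adversary AFTER the lateness `S n`). -/
  choose Cp hCp u p hreg hI hP tb htb1 htb0 hsl hbad using fun n : ℕ =>
    H (1 / (6 * ((n : ℝ) + 2) ^ 2)) (by positivity) ((n : ℝ) + 2)
      (by linarith [(Nat.cast_nonneg n : (0 : ℝ) ≤ n)]) (S n) (hS1 n)
  /- Step 2: the scales `cₙ = √(−t̄ₙ)` are small. -/
  obtain ⟨c, hcdef⟩ : ∃ c : ℕ → ℝ, ∀ n, c n = Real.sqrt (-tb n) := ⟨_, fun _ => rfl⟩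
  have hc : ∀ n, 0 < c n := fun n => by rw [hcdef]; exact Real.sqrt_pos.2 (by linarith [htb0 n])
  have htb1' : ∀ n, -1 < tb n := fun n => by
    have h1 : Real.exp (-S n) ≤ 1 := Real.exp_le_one_iff.2 (by linarith [hS1 n])
    linarith [htb1 n]
  have hIoo : ∀ n, tb n ∈ Ioo (-1 : ℝ) 0 := fun n => ⟨htb1' n, htb0 n⟩
  have hcA : ∀ n, c n * A n < 1 := fun n => by
    have h1 : -tb n < Real.exp (-S n) := by linarith [htb1 n]
    have h2 : c n < Real.exp (-(S n) / 2) := by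
      rw [hcdef, show -(S n) / 2 = -S n / 2 by ring, Real.exp_half]
      exact Real.sqrt_lt_sqrt (by linarith [htb0 n]) h1
    have h3 : Real.exp (-(S n) / 2) ≤ Real.exp (-A n) :=
      Real.exp_le_exp.2 (by linarith [le_max_right 1 (2 * A n), hS_def n])
    have h4 : Real.exp (-A n) * A n < 1 := by
      have h5 : A n < Real.exp (A n) := by linarith [Real.add_one_le_exp (A n)]
      rw [Real.exp_neg]
      calc (Real.exp (A n))⁻¹ * A n < (Real.exp (A n))⁻¹ * Real.exp (A n) := by
            gcongr
        _ = 1 := inv_mul_cancel₀ (Real.exp_pos _).ne'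
    calc c n * A n ≤ Real.exp (-A n) * A n :=
          mul_le_mul_of_nonneg_right (h2.trans_le h3).le (hA n).le
      _ < 1 := h4
  -- consequences of the smallness of `cₙ`
  have hcn1 : ∀ n, c n * ((n : ℝ) + 2) ≤ cmin n := fun n => by
    have h1 : ((n : ℝ) + 2) / cmin n ≤ A n := by
      rw [hA_def]; linarith [hR0]
    have h2 : (n : ℝ) + 2 ≤ A n * cmin n := by
      rw [div_le_iff₀ (hcmin n)] at h1; linarith
    calc c n * ((n : ℝ) + 2) ≤ c n * (A n * cmin n) := by gcongr; exact (hc n).le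
      _ = (c n * A n) * cmin n := by ring
      _ ≤ 1 * cmin n := by gcongr; exacts [(hcmin n).le, (hcA n).le]
      _ = cmin n := one_mul _
  have hcn2 : ∀ n, c n * ((n : ℝ) + 2) < 1 / 2 := fun n => by
    have h1 : 2 * ((n : ℝ) + 2) < A n := by
      rw [hA_def]
      have := div_pos (by positivity : (0 : ℝ) < (n : ℝ) + 2) (hcmin n)
      linarith
    have h2 : c n * (2 * ((n : ℝ) + 2)) < c n * A n := by gcongr; exact hc n
    linarith [hcA n]
  have hcn3 : ∀ n, 2 * R * c n ≤ 1 / 2 := fun n => by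
    have h1 : 4 * R < A n := by
      rw [hA_def]
      have := div_pos (by positivity : (0 : ℝ) < (n : ℝ) + 2) (hcmin n)
      have : (0 : ℝ) ≤ n := Nat.cast_nonneg n
      linarith
    have h2 : c n * (4 * R) < c n * A n := by gcongr; exact hc n
    linarith [hcA n]
  /- Step 3: the cut-off and the profiles. -/
  let χb : ContDiffBump (0 : EuclideanSpace ℝ (Fin 3)) := ⟨1 / 2, 3 / 4, by norm_num, by norm_num⟩
  obtain ⟨χ, hχdef⟩ : ∃ χ : EuclideanSpace ℝ (Fin 3) → ℝ, χ = ⇑χb := ⟨_, rfl⟩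
  have hχ : ContDiff ℝ (⊤ : ℕ∞) χ := by rw [hχdef]; exact χb.contDiff
  have hχs : tsupport χ ⊆ ball (0 : EuclideanSpace ℝ (Fin 3)) 1 := by
    rw [hχdef, χb.tsupport_eq]
    exact closedBall_subset_ball (by norm_num)
  have hχ1 : ∀ x ∈ ball (0 : EuclideanSpace ℝ (Fin 3)) (1 / 2), ∀ᶠ z in 𝓝 x, χ z = 1 :=
    fun x hx => by
      have h := χb.eventuallyEq_one_of_mem_ball hx
      rw [hχdef]
      exact h.mono fun z hz => by simpa using hz
  have hχabs : ∀ x, |χ x| ≤ 1 := fun x => by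
    rw [hχdef]
    exact abs_le.2 ⟨by linarith [χb.nonneg (x := x)], χb.le_one⟩
  have hχ0 : ∀ x, x ∉ ball (0 : EuclideanSpace ℝ (Fin 3)) 1 → χ x = 0 := fun x hx =>
    image_eq_zero_of_notMem_tsupport fun h => hx (hχs h)
  have hsec : ∀ n, spaceSection (Ico (-1 : ℝ) 0 ×ˢ ball (0 : EuclideanSpace ℝ (Fin 3)) 1) (tb n) =
      ball 0 1 := fun n => spaceSection_prod (Ioo_subset_Ico_self (hIoo n)) _
  have hus : ∀ n, ContDiffOn ℝ (⊤ : ℕ∞) (u n (tb n)) (ball (0 : EuclideanSpace ℝ (Fin 3)) 1) :=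
    fun n => by have := (hreg n).contDiffOn_velocity (tb n); rwa [hsec n] at this
  have hps : ∀ n, ContDiffOn ℝ (⊤ : ℕ∞) (p n (tb n)) (ball (0 : EuclideanSpace ℝ (Fin 3)) 1) :=
    fun n => by have := (hreg n).contDiffOn_pressure (tb n); rwa [hsec n] at this
  obtain ⟨F, hFdef⟩ : ∃ F : ℕ → EuclideanSpace ℝ (Fin 3) → EuclideanSpace ℝ (Fin 3),
      ∀ n, F n = fun y => c n • (χ (c n • y) • u n (tb n) (c n • y)) := ⟨_, fun _ => rfl⟩
  obtain ⟨Qf, hQdef⟩ : ∃ Qf : ℕ → EuclideanSpace ℝ (Fin 3) → ℝ,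
      ∀ n, Qf n = fun y => c n ^ 2 * (χ (c n • y) * p n (tb n) (c n • y)) := ⟨_, fun _ => rfl⟩
  have hFs : ∀ n, ContDiff ℝ (⊤ : ℕ∞) (F n) := fun n => by
    rw [hFdef]
    exact ((contDiff_cutoff_smul_of_contDiffOn isOpen_ball hχ hχs (hus n)).comp
      (contDiff_id.const_smul (c n))).const_smul (c n)
  have hQs : ∀ n, ContDiff ℝ (⊤ : ℕ∞) (Qf n) := fun n => by
    rw [hQdef]
    exact ((contDiff_cutoff_smul_of_contDiffOn isOpen_ball hχ hχs (hps n)).comp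
      (contDiff_id.const_smul (c n))).const_smul (c n ^ 2)
  have hF3 : ∀ n, ContDiff ℝ 3 (F n) := fun n => contDiff_infty.1 (hFs n) 3
  have hQ1 : ∀ n, ContDiff ℝ 1 (Qf n) := fun n => contDiff_infty.1 (hQs n) 1
  have hQd : ∀ n, Differentiable ℝ (Qf n) := fun n => (hQ1 n).differentiable one_ne_zero
  -- where the bounds hold
  have hgood : ∀ m n : ℕ, m ≤ n → ∀ y ∈ closedBall (0 : EuclideanSpace ℝ (Fin 3)) ((m : ℝ) + 1),
      c n * (1 + ‖y‖) ≤ cmin n ∧ c n • y ∈ ball (0 : EuclideanSpace ℝ (Fin 3)) (1 / 2) ∧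
        c n • y ∈ ball (0 : EuclideanSpace ℝ (Fin 3)) 1 := by
    intro m n hmn y hy
    rw [mem_closedBall_zero_iff] at hy
    have hmn' : (m : ℝ) ≤ n := by exact_mod_cast hmn
    have h1 : c n * (1 + ‖y‖) ≤ c n * ((n : ℝ) + 2) :=
      mul_le_mul_of_nonneg_left (by linarith) (hc n).le
    have h2 : ‖c n • y‖ < 1 / 2 := by
      rw [norm_smul, Real.norm_of_nonneg (hc n).le]
      have : c n * ‖y‖ ≤ c n * ((n : ℝ) + 2) :=
        mul_le_mul_of_nonneg_left (by linarith [norm_nonneg y]) (hc n).le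
      linarith [hcn2 n]
    exact ⟨h1.trans (hcn1 n), mem_ball_zero_iff.2 h2, mem_ball_zero_iff.2 (by linarith)⟩
  -- the Type I bound of the profiles (everywhere)
  have hFI : ∀ n y, ‖F n y‖ ≤ Cu / (1 + ‖y‖) := by
    intro n y
    rw [hFdef]
    dsimp only
    by_cases hy : c n • y ∈ ball (0 : EuclideanSpace ℝ (Fin 3)) 1
    · have hIu := hI n (tb n) (Ioo_subset_Ico_self (hIoo n)) (c n • y) hy
      rw [← hcdef n, norm_smul, Real.norm_of_nonneg (hc n).le,
        show c n + c n * ‖y‖ = c n * (1 + ‖y‖) by ring] at hIu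
      have hpos : 0 < 1 + ‖y‖ := by positivity
      rw [norm_smul, norm_smul, Real.norm_of_nonneg (hc n).le, Real.norm_eq_abs]
      calc c n * (|χ (c n • y)| * ‖u n (tb n) (c n • y)‖)
          ≤ c n * (1 * (Cu / (c n * (1 + ‖y‖)))) :=
            mul_le_mul_of_nonneg_left
              (mul_le_mul (hχabs _) hIu (norm_nonneg _) zero_le_one) (hc n).le
        _ = Cu / (1 + ‖y‖) := by
            rw [one_mul, ← mul_div_assoc, mul_div_mul_left _ _ (hc n).ne']
    · rw [hχ0 _ hy, zero_smul, smul_zero, norm_zero]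
      positivity
  -- the derivative bounds of orders `0, …, 3` on `B̄(0, m+1)` for `n ≥ m`
  have hDk : ∀ k m n : ℕ, m ≤ n → cmin n ≤ c₁ k →
      ∀ y ∈ closedBall (0 : EuclideanSpace ℝ (Fin 3)) ((m : ℝ) + 1),
        ‖iteratedFDeriv ℝ k (F n) y‖ ≤ K k := by
    intro k m n hmn hk y hy
    obtain ⟨hsm, hcy, hcy1⟩ := hgood m n hmn y hy
    have h := norm_iteratedFDeriv_cutoffProfile_le'
      (Hd k (u n) (p n) (hreg n) (hI n)) (hreg n) hχ hχs (hIoo n) (hcdef n)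
      (hFdef n) (hχ1 _ hcy) (hsm.trans hk)
    refine h.trans (div_le_self (hK0 k) (one_le_pow₀ (by linarith [norm_nonneg y])))
  obtain ⟨Kmax, hKmax_def⟩ : ∃ Kmax : ℝ, Kmax = max (max (K 0) (K 1)) (max (K 2) (K 3)) := ⟨_, rfl⟩
  have hbB : ∀ m n : ℕ, m ≤ n → ∀ y ∈ closedBall (0 : EuclideanSpace ℝ (Fin 3)) ((m : ℝ) + 1),
      ‖F n y‖ ≤ Kmax ∧ ‖fderiv ℝ (F n) y‖ ≤ Kmax ∧ ‖fderiv ℝ (fderiv ℝ (F n)) y‖ ≤ Kmax ∧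
        ‖fderiv ℝ (fderiv ℝ (fderiv ℝ (F n))) y‖ ≤ Kmax := by
    intro m n hmn y hy
    refine ⟨?_, ?_, ?_, ?_⟩
    · rw [← norm_iteratedFDeriv_zero (𝕜 := ℝ) (f := F n)]
      exact (hDk 0 m n hmn (hcm0 n) y hy).trans
        (by rw [hKmax_def]; exact (le_max_left _ _).trans (le_max_left _ _))
    · rw [← norm_iteratedFDeriv_zero (𝕜 := ℝ) (f := fderiv ℝ (F n)), norm_iteratedFDeriv_fderiv]
      exact (hDk 1 m n hmn (hcm1 n) y hy).trans
        (by rw [hKmax_def]; exact (le_max_right _ _).trans (le_max_left _ _))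
    · rw [← norm_iteratedFDeriv_zero (𝕜 := ℝ) (f := fderiv ℝ (fderiv ℝ (F n))),
        norm_iteratedFDeriv_fderiv, norm_iteratedFDeriv_fderiv]
      exact (hDk 2 m n hmn (hcm2 n) y hy).trans
        (by rw [hKmax_def]; exact (le_max_left _ _).trans (le_max_right _ _))
    · rw [← norm_iteratedFDeriv_zero (𝕜 := ℝ) (f := fderiv ℝ (fderiv ℝ (fderiv ℝ (F n)))),
        norm_iteratedFDeriv_fderiv, norm_iteratedFDeriv_fderiv, norm_iteratedFDeriv_fderiv]
      exact (hDk 3 m n hmn (hcm3 n) y hy).trans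
        (by rw [hKmax_def]; exact (le_max_right _ _).trans (le_max_right _ _))
  /- Step 4: the hypotheses of the compactness–Liouville lemma: divergence, and the curl of the profile residual, which near
  every core point is minus the vorticity defect of the window field. -/
  have hdiv0 : ∀ m n : ℕ, m ≤ n → ∀ y ∈ closedBall (0 : EuclideanSpace ℝ (Fin 3)) ((m : ℝ) + 1),
      VectorCalculus.divergence (F n) y = 0 := fun m n hmn y hy => by
    obtain ⟨-, hcy, hcy1⟩ := hgood m n hmn y hy
    exact divergence_cutoffProfile_eq_zero' (hreg n) (htb1' n) (htb0 n) (hcdef n) (hFdef n) hcy1 (hχ1 _ hcy)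
  have hQ2 : ∀ n, ContDiff ℝ 2 (Qf n) := fun n => contDiff_infty.1 (hQs n) 2
  have hcurl : ∀ m n : ℕ, m ≤ n → ∀ y ∈ closedBall (0 : EuclideanSpace ℝ (Fin 3)) ((m : ℝ) + 1),
      ‖curl (fun z => -((Δ (F n)) z) + (1 / 2 : ℝ) • F n z + (1 / 2 : ℝ) • fderiv ℝ (F n) z z +
          convect (F n) (F n) z) y‖ ≤ 1 / (6 * ((n : ℝ) + 2) ^ 2) := by
    intro m n hmn y hy
    obtain ⟨-, hcy, -⟩ := hgood m n hmn y hy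
    -- the cut-off profile agrees with the window field near `y`
    have hFW : F n =ᶠ[𝓝 y] fun w => c n • u n (tb n) (c n • w) := by
      rw [hFdef n]; exact cutoffProfile_eventuallyEq (u := u n) (hχ1 _ hcy) (tb n)
    have hev : ∀ᶠ z in 𝓝 y, F n =ᶠ[𝓝 z] fun w => c n • u n (tb n) (c n • w) := hFW.eventually_nhds
    have hN : (fun z => -((Δ (F n)) z) + (1 / 2 : ℝ) • F n z + (1 / 2 : ℝ) • fderiv ℝ (F n) z z +
          convect (F n) (F n) z) =ᶠ[𝓝 y]
        fun z => -((1 : ℝ) • (Δ (fun w => c n • u n (tb n) (c n • w))) z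
          - fderiv ℝ (fun w => c n • u n (tb n) (c n • w)) z (c n • u n (tb n) (c n • z))
          - (1 / 2 : ℝ) • (c n • u n (tb n) (c n • z))
          - (1 / 2 : ℝ) • fderiv ℝ (fun w => c n • u n (tb n) (c n • w)) z z) := by
      filter_upwards [hev] with z hz
      simp only [convect]
      rw [(InnerProductSpace.laplacian_congr_nhds hz).eq_of_nhds, hz.fderiv_eq, hz.eq_of_nhds, one_smul]
      abel
    -- the datum at `y ∈ B(0, n+2)`
    have hyL : y ∈ ball (0 : EuclideanSpace ℝ (Fin 3)) ((n : ℝ) + 2) := by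
      rw [mem_closedBall_zero_iff] at hy
      rw [mem_ball_zero_iff]
      have : (m : ℝ) ≤ n := by exact_mod_cast hmn
      linarith
    have hdat := hsl n (fun w => c n • u n (tb n) (c n • w)) (by rw [hcdef n]) y hyL
    beta_reduce at hdat
    rw [curl_congr_fderiv hN.fderiv_eq, curl_eq_curlCLM, fderiv_fun_neg, map_neg, norm_neg, ← curl_eq_curlCLM]
    exact hdat
  /- Step 5: the compactness–Liouville lemma (curl form) against the largeness of the vorticity in similarity variables. -/
  obtain ⟨n, hn⟩ :=
    exists_curl_small_of_approxLerayProfiles_curl hCu F Qf hF3 hQ2 hbB hFI hdiv0 hcurl θ hθ R hR0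
  have hlow : ENNReal.ofReal (θ ^ 2 / 4) <
      ∫⁻ y in ball (0 : EuclideanSpace ℝ (Fin 3)) (2 * R), ENNReal.ofReal (‖curl (F n) y‖ ^ 2) := by
    have hb := hbad n
    rw [← hcdef n] at hb
    rw [lintegral_ball_curl_cutoffProfile' hχ1 (htb0 n) (hcdef n) (hFdef n) hR0 (hcn3 n)]
    have hc0 : ENNReal.ofReal (c n) ≠ 0 := (ENNReal.ofReal_pos.2 (hc n)).ne'
    have hcne : c n ≠ 0 := (hc n).ne'
    calc ENNReal.ofReal (θ ^ 2 / 4)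
        = ENNReal.ofReal (c n) * ENNReal.ofReal (θ ^ 2 / (4 * c n)) := by
          rw [← ENNReal.ofReal_mul (hc n).le, ← mul_div_assoc, mul_comm (c n) (θ ^ 2),
            mul_div_mul_right _ _ hcne]
      _ < ENNReal.ofReal (c n) *
          ∫⁻ x in ball (0 : EuclideanSpace ℝ (Fin 3)) (2 * R * c n),
            ENNReal.ofReal (‖curl (u n (tb n)) x‖ ^ 2) :=
          ENNReal.mul_lt_mul_right hc0 ENNReal.ofReal_ne_top hb
  exact lt_irrefl _ (hlow.trans_le hn)

end Summit.NavierStokesRegularity.NavierStokesRegularity.Theorems.ScalingDefectPeepholeDoor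

end
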